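import Summits.ValiantsHypothesis.ValiantsHypothesis.Theorems.MonotoneRestorationOrbitRestorationQPDepthThreeRungDefs
import Summits.ValiantsHypothesis.ValiantsHypothesis.Theorems.MonotoneRestorationOrbitRestorationQPVsbr
import Summits.ValiantsHypothesis.ValiantsHypothesis.Theorems.MonotoneRestorationOrbitRestorationQPValueOrbitIff
import Summits.ValiantsHypothesis.ValiantsHypothesis.Theorems.MonotoneRestorationOrbitRestorationQPValueOrbitPer
import Summits.ValiantsHypothesis.ValiantsHypothesis.Theorems.MonotoneRestorationQP.Negative.OrbitRestorationFalseOfPolylogWidthVP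
import Literature.ModelTheory.FiniteModelTheory.CkEquiv
import HarnessLib

/-!
# Route MonotoneRestoration — crux `OrbitRestorationQP` (stmt-ValiantsHypothesis-18293), line `depth-three-rung`:
# CALIBRATION OF THE TWO OPEN STUBS (kill instrument and lower-bound content of the rung `A_∞` and of the limit)

The registered skeleton `Cruxes/OrbitRestorationQP/Lines/depth_three_rung.lean` (5d811172) has two open stubs:
the RUNG `stub_sigmaPiSigmaValue` (`A_∞`: every matrix-symmetric family of polynomial `ΣΠΣ` complexity —
`PDClass (fun _ => 1)` — is quasi-polynomially ORBIT-restorable) and the LIMIT `stub_logDepthRestoration`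
(the same for product depth `c₀ (log₂ n + 1)`; the crux modulo VSBR).  This file records, def-free and with the
two stub statements QUOTED VERBATIM as hypotheses, what each of them DECIDES — i.e. their refutation instrument
and their lower-bound content — by composing three landed engines:

* the Dawar–Wilsenach orbit pipeline `not_qpOrbitSymmetric_of_polylogSeparating`
  (`Theorems/MonotoneRestorationQP/Negative/OrbitRestorationFalseOfPolylogWidthVP.lean`: a family whose values
  separate `≡^{C^{(log₂ m + c)^c}}`-equivalent graphs beyond every order has no square-symmetric circuits of
  quasi-polynomial orbit);
* the converse of value-orbit symmetrisation `SymmetricValues.exists_valueDerivation_of_symmetric`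
  (`…ValueOrbitIff.lean`: a symmetric circuit yields a value derivation with value orbits `≤ ORB`);
* `ValueOrbit.perPoly_not_valueOrbitQP` (`…ValueOrbitPer.lean`: the permanent has no quasi-polynomial
  value-orbit computations — Dawar–Wilsenach Thm 7.1, PROVED in the tree, `DawarWilsenach2025_thm71_holds`).

Results (namespace `…Theorems.OrbitRestorationQPDepthThreeRung.RungCalibration`):

* `sigmaPiSigmaValue_false_of_separating` — **KILL INSTRUMENT OF THE RUNG, IN ITS OWN CURRENCY**: one
  matrix-symmetric family in `PDClass 1` (polynomial `ΣΠΣ` = depth three) whose values at `0/1` adjacency matrices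
  separate, at every level `c` and beyond every order, two `≡^{C^{(log₂ m + c)^c}}`-equivalent graphs refutes
  `A_∞` (hence the line and, by `onPath`, the crux).  This is the weakest typed kill hypothesis of the crux
  (`PolylogWidthVP`) intersected with the rung's hypothesis class; no such family is known (a depth-three
  "arithmetic CFI family" in characteristic `0`).
* `not_pdClassOne_of_not_valueOrbitQP` — **LOWER-BOUND CONTENT OF THE RUNG**: under `A_∞`, every
  matrix-symmetric family WITHOUT quasi-polynomial value-orbit computations lies OUTSIDE polynomial `ΣΠΣ`.
  So `A_∞` is a transfer principle: symmetric-circuit (counting-width) lower bounds become depth-three lower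
  bounds over `ℂ` for matrix-symmetric families.
* `perPoly_not_pdClassOne_of_sigmaPiSigmaValue` — the instance: **`A_∞` implies that the permanent has no
  polynomial-size depth-three (`ΣΠΣ`) circuits over `ℂ`** (in the tree's `PDClass 1` envelope).  Unconditionally
  this consequence is known only through Limaye–Srinivasan–Tavenas 2021 (superpolynomial `ΣΠΣ` lower bounds for
  `IMM` in characteristic `0`) composed with `VNP`-completeness of `per`; it is not in the tree.  Any proof of the
  rung therefore carries, together with Dawar–Wilsenach Thm 7.1, a superpolynomial depth-three lower bound for the
  permanent in characteristic zero.
* `not_pdClassLog_of_not_valueOrbitQP`, `perPoly_not_vpClass_of_logDepthRestoration` — the same for the LIMIT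
  stub: with the landed VSBR stub (`stub_vsbr`) the limit puts the permanent outside `VPClass` at some order for
  every exponent, i.e. it decides Valiant's hypothesis for `per` in the line's currency (consistent with the
  crux being the sole binder of `closes`).

Nothing here proves or refutes a stub; both stay open.  VP ≠ VNP is not touched. [folklore]

## References
* A. Dawar, G. Wilsenach, *Symmetric arithmetic circuits*, ToC 21 (2025), Thms 5.1, 6.2–6.4, 7.1, §8.
  [DawarWilsenach2025]
* N. Limaye, S. Srinivasan, S. Tavenas, *Superpolynomial lower bounds against low-depth algebraic circuits*,
  FOCS 2021, Cor. 4. [LimayeSrinivasanTavenas2021]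
* L. G. Valiant, S. Skyum, S. Berkowitz, C. Rackoff, *Fast parallel computation of polynomials using few
  processors*, SIAM J. Comput. 12 (1983). [VSBR1983]
-/

noncomputable section

open scoped Classical

-- `Summit.ValiantsHypothesis.ValiantsHypothesis.…` is the tree's single-conjunct layout (Sub = Summit).
set_option linter.dupNamespace false

namespace Summit.ValiantsHypothesis.ValiantsHypothesis.Theorems.OrbitRestorationQPDepthThreeRung

namespace RungCalibration

open Literature.Computability.AlgebraicComplexity
open Literature.ModelTheory.FiniteModelTheory
open Summit.ValiantsHypothesis.ValiantsHypothesis.Theorems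

/-! ### The rung `A_∞` -/

/-- **Kill instrument of the rung `A_∞` in `ΣΠΣ` currency.**  A matrix-symmetric family of polynomial
depth-three complexity (`PDClass 1`) whose values at `0/1` adjacency matrices separate, for every level `c` and
beyond every order `N`, two `≡^{C^{(log₂ m + c)^c}}`-equivalent graphs on `Fin m` refutes the registered stub
`stub_sigmaPiSigmaValue` (quoted verbatim as the negated statement): the Dawar–Wilsenach orbit pipeline
`not_qpOrbitSymmetric_of_polylogSeparating` applied to the quasi-polynomial-orbit circuits the stub would provide.
[cite: DawarWilsenach2025, Thms 5.1 and 6.2–6.4] -/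
theorem sigmaPiSigmaValue_false_of_separating
    (H : ∃ f : (n : ℕ) → MvPolynomial (Fin n × Fin n) ℂ, IsMatrixSymmetric f ∧
      (∃ c : ℕ, ∀ n : ℕ, PDClass (fun _ => 1) n c (f n)) ∧
      ∀ c N : ℕ, ∃ m : ℕ, N ≤ m ∧ ∃ X Y : SimpleGraph (Fin m),
        CkEquiv ((Nat.log 2 m + c) ^ c) X Y ∧
          MvPolynomial.eval (Set.indicator {ij : Fin m × Fin m | X.Adj ij.1 ij.2} 1) (f m) ≠
            MvPolynomial.eval (Set.indicator {ij : Fin m × Fin m | Y.Adj ij.1 ij.2} 1) (f m)) :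
    ¬ ∀ f : (n : ℕ) → MvPolynomial (Fin n × Fin n) ℂ, IsMatrixSymmetric f →
        (∃ c : ℕ, ∀ n : ℕ, PDClass (fun _ => 1) n c (f n)) →
        ∃ c : ℕ, ∀ n : ℕ, QPOrbitRestorable c n (f n) := by
  intro hA
  obtain ⟨f, hsym, hPD, hsep⟩ := H
  obtain ⟨c, hc⟩ := hA f hsym hPD
  exact not_qpOrbitSymmetric_of_polylogSeparating f hsep ⟨c, fun n => hc n⟩

/-- From a square-symmetric circuit of quasi-polynomial orbit to a value derivation of quasi-polynomial value
orbits (the converse of value-orbit symmetrisation, one level). [folklore] -/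
theorem valueOrbit_of_qpOrbitRestorable {c n : ℕ} {p : MvPolynomial (Fin n × Fin n) ℂ}
    (h : QPOrbitRestorable c n p) :
    ∃ 𝒟 : ValueDerivation ℂ (Fin n × Fin n), p ∈ 𝒟.S ∧
      ∀ q ∈ 𝒟.S, (Set.range fun σ : Equiv.Perm (Fin n) => ren σ q).ncard ≤ 2 ^ ((Nat.log 2 n + c) ^ c) := by
  obtain ⟨G, inst, C, hCsym, hCev, hCorb⟩ := h
  obtain ⟨𝒟, hp, hS⟩ := SymmetricValues.exists_valueDerivation_of_symmetric C hCsym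
  exact ⟨𝒟, hCev ▸ hp, fun q hq => (hS q hq).trans hCorb⟩

/-- **Lower-bound content of the rung.**  Under `A_∞` (quoted verbatim as the hypothesis `hA`), a
matrix-symmetric family admitting NO quasi-polynomial value-orbit computations (for every exponent `c`, at some
order every value derivation of `f n` has a value of orbit `> 2^((log₂ n + c)^c)`) is outside polynomial `ΣΠΣ`:
it lies in `PDClass 1 · c` for no `c`.  (`A_∞` would give quasi-polynomial-orbit circuits, whose gate values form
a value derivation of quasi-polynomial orbits.) [folklore] -/
theorem not_pdClassOne_of_not_valueOrbitQP
    (hA : ∀ f : (n : ℕ) → MvPolynomial (Fin n × Fin n) ℂ, IsMatrixSymmetric f →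
        (∃ c : ℕ, ∀ n : ℕ, PDClass (fun _ => 1) n c (f n)) →
        ∃ c : ℕ, ∀ n : ℕ, QPOrbitRestorable c n (f n))
    {f : (n : ℕ) → MvPolynomial (Fin n × Fin n) ℂ} (hsym : IsMatrixSymmetric f)
    (hno : ∀ c : ℕ, ¬ ∀ n : ℕ, ∃ 𝒟 : ValueDerivation ℂ (Fin n × Fin n), f n ∈ 𝒟.S ∧
      ∀ q ∈ 𝒟.S, (Set.range fun σ : Equiv.Perm (Fin n) => ren σ q).ncard ≤ 2 ^ ((Nat.log 2 n + c) ^ c)) :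
    ¬ ∃ c : ℕ, ∀ n : ℕ, PDClass (fun _ => 1) n c (f n) := by
  intro hPD
  obtain ⟨c, hc⟩ := hA f hsym hPD
  exact hno c fun n => valueOrbit_of_qpOrbitRestorable (hc n)

/-- The permanent family over `ℂ` is matrix-symmetric (independent row and column permutations), in the
line's vocabulary `IsMatrixSymmetric`. [folklore] -/
theorem isMatrixSymmetric_perPoly : IsMatrixSymmetric fun n => perPoly (Fin n) ℂ := by
  intro n σ τ
  have h' := congrArg (MvPolynomial.map (Complex.ofRealHom.comp NNReal.toRealHom))
    (MonotoneRestorationQP.Negative.rename_perm_perPoly n σ τ)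
  rw [MvPolynomial.map_rename, map_perPoly] at h'
  exact h'

/-- **`A_∞` implies a superpolynomial depth-three lower bound for the permanent over `ℂ`.**  Under the rung
`stub_sigmaPiSigmaValue` (quoted verbatim as `hA`) there is no exponent `c` with `per_n ∈ PDClass 1 n c` for all
`n` — no polynomial-size `ΣΠΣ` circuits (with the class's degree/complexity envelope) for the permanent in
characteristic zero.  Ingredients: `not_pdClassOne_of_not_valueOrbitQP` and Dawar–Wilsenach Thm 7.1 in the
form `ValueOrbit.perPoly_not_valueOrbitQP` (proved in the tree).  Unconditionally the conclusion is known only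
via Limaye–Srinivasan–Tavenas 2021 and `VNP`-completeness; it is not claimed here.
[cite: DawarWilsenach2025, Thm 7.1; LimayeSrinivasanTavenas2021, Cor. 4] -/
theorem perPoly_not_pdClassOne_of_sigmaPiSigmaValue
    (hA : ∀ f : (n : ℕ) → MvPolynomial (Fin n × Fin n) ℂ, IsMatrixSymmetric f →
        (∃ c : ℕ, ∀ n : ℕ, PDClass (fun _ => 1) n c (f n)) →
        ∃ c : ℕ, ∀ n : ℕ, QPOrbitRestorable c n (f n)) :
    ¬ ∃ c : ℕ, ∀ n : ℕ, PDClass (fun _ => 1) n c (perPoly (Fin n) ℂ) :=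
  not_pdClassOne_of_not_valueOrbitQP hA isMatrixSymmetric_perPoly
    fun c => ValueOrbit.perPoly_not_valueOrbitQP c

/-! ### The limit stub -/

/-- **Lower-bound content of the limit stub.**  Under `stub_logDepthRestoration` (quoted verbatim as `hL`), a
matrix-symmetric family without quasi-polynomial value-orbit computations has, for every `c₀`, no polynomial-size
circuits of product depth `≤ c₀ (log₂ n + 1)` (`PDClass (fun n => c₀ * (Nat.log 2 n + 1)) n c` for no `c`).
[folklore] -/
theorem not_pdClassLog_of_not_valueOrbitQP
    (hL : ∀ c₀ : ℕ, ∀ f : (n : ℕ) → MvPolynomial (Fin n × Fin n) ℂ, IsMatrixSymmetric f →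
        (∃ c : ℕ, ∀ n : ℕ, PDClass (fun n => c₀ * (Nat.log 2 n + 1)) n c (f n)) →
        ∃ c : ℕ, ∀ n : ℕ, QPOrbitRestorable c n (f n))
    {f : (n : ℕ) → MvPolynomial (Fin n × Fin n) ℂ} (hsym : IsMatrixSymmetric f)
    (hno : ∀ c : ℕ, ¬ ∀ n : ℕ, ∃ 𝒟 : ValueDerivation ℂ (Fin n × Fin n), f n ∈ 𝒟.S ∧
      ∀ q ∈ 𝒟.S, (Set.range fun σ : Equiv.Perm (Fin n) => ren σ q).ncard ≤ 2 ^ ((Nat.log 2 n + c) ^ c))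
    (c₀ : ℕ) : ¬ ∃ c : ℕ, ∀ n : ℕ, PDClass (fun n => c₀ * (Nat.log 2 n + 1)) n c (f n) := by
  intro hPD
  obtain ⟨c, hc⟩ := hL c₀ f hsym hPD
  exact hno c fun n => valueOrbit_of_qpOrbitRestorable (hc n)

/-- **The limit stub decides Valiant's hypothesis for the permanent, in the line's currency.**  Under
`stub_logDepthRestoration` (quoted verbatim as `hL`) there is no exponent `c` with `per_n ∈ VPClass n c` for all
`n`: the landed VSBR stub `stub_vsbr` puts any such family in a product-depth-`O(log n)` slice, which the limit
would restore, contradicting Dawar–Wilsenach Thm 7.1.  (This is the crux's `closes` read through the ladder;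
recorded so that the limit's strength is visible next to the rung's.) [cite: DawarWilsenach2025, Thm 7.1; VSBR1983, Thm. 3] -/
theorem perPoly_not_vpClass_of_logDepthRestoration
    (hL : ∀ c₀ : ℕ, ∀ f : (n : ℕ) → MvPolynomial (Fin n × Fin n) ℂ, IsMatrixSymmetric f →
        (∃ c : ℕ, ∀ n : ℕ, PDClass (fun n => c₀ * (Nat.log 2 n + 1)) n c (f n)) →
        ∃ c : ℕ, ∀ n : ℕ, QPOrbitRestorable c n (f n)) :
    ¬ ∃ c : ℕ, ∀ n : ℕ, VPClass n c (perPoly (Fin n) ℂ) := by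
  intro hVP
  obtain ⟨c₀, c', hc'⟩ := stub_vsbr (fun n => perPoly (Fin n) ℂ) hVP
  exact not_pdClassLog_of_not_valueOrbitQP hL isMatrixSymmetric_perPoly
    (fun c => ValueOrbit.perPoly_not_valueOrbitQP c) c₀ ⟨c', hc'⟩

end RungCalibration

end Summit.ValiantsHypothesis.ValiantsHypothesis.Theorems.OrbitRestorationQPDepthThreeRung

end
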